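import Mathlib
import Literature.Analysis.PDE.FarChannelsKernelTransfer
import Literature.Analysis.Calculus.MonomialFrameBound
import HarnessLib

/-!
# The span of the true kernel towers: transfer of the data distance to the exact energy

Analysis/PDE support file (everything proved, no definitions). Combination of the kernel transfer
inequality (`FarChannelsKernelTransfer.kernelTransfer_energy_le`) with the monomial frame bounds
(`MonomialFrameBound`): for the true kernel element `Q_{a,b}` (Cauchy data `tpos, tvel`) and its
exact shadow `k = (Σ_k a_k ι^{ℓ−2k}, Σ_k b_k ι^{ℓ−2k})`,

  `∫_{x>ρ} e_V[dat Q_{a,b} − k] ≤ (Kf/ρ) ∫_{x>ρ} e₀[k]`     (`ρ ≥ x₁`),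

where `e₀[k] = kvel² + kpos'² + ℓ(ℓ+1)ι² kpos²` is the exact energy density of `k`
(`farTrueSpan_transfer`; the frame bounds turn `Σ a_k² ρ^{4k−2ℓ−1} + Σ b_k² ρ^{4k−2ℓ+1}` into the
exact energy, after re-indexing the even-parity monomials, `sum_range_ite_even`). Route
PhotonSphereChannels, `FixedModeChannels`, far side (stmt-FinalStateConjecture-10048): with the
exact channel inequality this makes the true kernel as good as the exact one for large `ρ`.
Folklore.
-/

noncomputable section

namespace Literature.Analysis.PDE

open MeasureTheory Set Filter Topology Finset Literature.Analysis.Calculus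

/-- Re-indexing an even-parity sum: `Σ_{j<N, j even} f j = Σ_{k<M} f (2k)` when
`k < M ↔ 2k < N`. [folklore] -/
theorem sum_range_ite_even (f : ℕ → ℝ) {N M : ℕ} (hNM : ∀ k, k < M ↔ 2 * k < N) :
    ∑ j ∈ range N, (if Even j then f j else 0) = ∑ k ∈ range M, f (2 * k) := by
  rw [← Finset.sum_filter]
  have hset : (range N).filter Even = (range M).image (fun k => 2 * k) := by
    ext j
    simp only [Finset.mem_filter, Finset.mem_range, Finset.mem_image]
    constructor
    · rintro ⟨hj, ⟨k, hk⟩⟩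
      exact ⟨k, (hNM k).2 (by omega), by omega⟩
    · rintro ⟨k, hk, rfl⟩
      exact ⟨(hNM k).1 hk, even_two_mul k⟩
  rw [hset, Finset.sum_image fun x _ y _ h => by simpa using h]

variable {ι V : ℝ → ℝ} {E : ℕ → ℝ → ℝ} {ℓ : ℕ} {x₁ K W₀ : ℝ}

/-- **Transfer of the data distance of `Q_{a,b}` to the exact energy of its shadow.** See the module
docstring. [folklore] -/
theorem farTrueSpan_transfer (hι : ContDiff ℝ (⊤ : ℕ∞) ι)
    (hιeq : ∀ x : ℝ, 1 / 2 ≤ x → ι x = x⁻¹) (hℓ : 1 ≤ ℓ) (hx₁ : 1 ≤ x₁) (hW₀ : 0 ≤ W₀)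
    (hEC : ∀ j, j ≤ ℓ → ContDiff ℝ 2 (E j))
    (hEb : ∀ j, j ≤ ℓ → ∀ x, x₁ ≤ x →
      |E j x - (∏ i ∈ range ℓ, ((j : ℝ) - 2 * i - 1)) * ι x ^ (ℓ - j)| ≤ K * x ^ ((j : ℝ) - ℓ - 1 / 2) ∧
      |deriv (E j) x - deriv (fun y => (∏ i ∈ range ℓ, ((j : ℝ) - 2 * i - 1)) * ι y ^ (ℓ - j)) x|
        ≤ K * x ^ ((j : ℝ) - ℓ - 3 / 2))
    (hV : Continuous V) (hV0 : ∀ x, 0 ≤ V x) (hVW : ∀ x, x₁ ≤ x → V x ≤ W₀ * x ^ (-(2 : ℝ))) :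
    ∃ Kf : ℝ, 0 ≤ Kf ∧ ∀ (a b : ℕ → ℝ) (ρ : ℝ), x₁ ≤ ρ → ∀ (Q : ℝ → ℝ → ℝ),
      (∀ y, Q 0 y
        = ∑ k ∈ range (ℓ / 2 + 1), a k / (∏ i ∈ range ℓ, (((2 * k : ℕ) : ℝ) - 2 * i - 1)) * E (2 * k) y
          + ∑ k ∈ range ((ℓ + 1) / 2), b k / (((2 * k + 1 : ℕ) : ℝ)
              * ∏ i ∈ range ℓ, (((2 * k : ℕ) : ℝ) - 2 * i - 1)) * E (2 * k + 1) y) →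
      (∀ z, deriv (fun τ => Q τ z) 0
        = ∑ k ∈ range (ℓ / 2 + 1), a k / (∏ i ∈ range ℓ, (((2 * k : ℕ) : ℝ) - 2 * i - 1))
              * ((2 * k : ℕ) : ℝ) * E (2 * k - 1) z
          + ∑ k ∈ range ((ℓ + 1) / 2), b k / (((2 * k + 1 : ℕ) : ℝ)
              * ∏ i ∈ range ℓ, (((2 * k : ℕ) : ℝ) - 2 * i - 1)) * (((2 * k + 1 : ℕ) : ℝ) * E (2 * k) z)) →
      IntegrableOn (fun x => (∑ k ∈ range ((ℓ + 1) / 2), b k * ι x ^ (ℓ - 2 * k)) ^ 2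
        + deriv (fun y => ∑ k ∈ range (ℓ / 2 + 1), a k * ι y ^ (ℓ - 2 * k)) x ^ 2
        + ℓ * (ℓ + 1) * ι x ^ 2 * (∑ k ∈ range (ℓ / 2 + 1), a k * ι x ^ (ℓ - 2 * k)) ^ 2) (Ioi ρ) →
      IntegrableOn (fun x =>
        (deriv (fun τ => Q τ x) 0 - ∑ k ∈ range ((ℓ + 1) / 2), b k * ι x ^ (ℓ - 2 * k)) ^ 2
        + deriv (fun y => Q 0 y - ∑ k ∈ range (ℓ / 2 + 1), a k * ι y ^ (ℓ - 2 * k)) x ^ 2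
        + V x * (Q 0 x - ∑ k ∈ range (ℓ / 2 + 1), a k * ι x ^ (ℓ - 2 * k)) ^ 2) (Ioi ρ) ∧
      ∫ x in Ioi ρ, ((deriv (fun τ => Q τ x) 0 - ∑ k ∈ range ((ℓ + 1) / 2), b k * ι x ^ (ℓ - 2 * k)) ^ 2
        + deriv (fun y => Q 0 y - ∑ k ∈ range (ℓ / 2 + 1), a k * ι y ^ (ℓ - 2 * k)) x ^ 2
        + V x * (Q 0 x - ∑ k ∈ range (ℓ / 2 + 1), a k * ι x ^ (ℓ - 2 * k)) ^ 2)
      ≤ Kf / ρ * ∫ x in Ioi ρ, ((∑ k ∈ range ((ℓ + 1) / 2), b k * ι x ^ (ℓ - 2 * k)) ^ 2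
        + deriv (fun y => ∑ k ∈ range (ℓ / 2 + 1), a k * ι y ^ (ℓ - 2 * k)) x ^ 2
        + ℓ * (ℓ + 1) * ι x ^ 2 * (∑ k ∈ range (ℓ / 2 + 1), a k * ι x ^ (ℓ - 2 * k)) ^ 2) := by
  obtain ⟨Kt, hKt0, hKT⟩ := kernelTransfer_energy_le hι hιeq hx₁ hW₀ hEC hEb hV hV0 hVW
  obtain ⟨σ₁, hσ₁, hF₁⟩ := monomial_frame_bound ℓ ℓ le_rfl
  obtain ⟨σ₂, hσ₂, hF₂⟩ := monomial_frame_bound_weighted ℓ (ℓ + 1) le_rfl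
  refine ⟨Kt * (σ₁⁻¹ + (2 * σ₂)⁻¹), by positivity, ?_⟩
  intro a b ρ hρ Q hQ0 hQ1 hkex
  have hρ1 : 1 ≤ ρ := hx₁.trans hρ
  have hρ0 : 0 < ρ := by linarith
  have hn2 : (2 : ℝ) ≤ ℓ * (ℓ + 1) := by
    have : (1 : ℝ) ≤ ℓ := by exact_mod_cast hℓ
    nlinarith
  -- the kernel transfer, rewritten with the data of `Q`
  obtain ⟨hKi, hKle⟩ := hKT a b ρ hρ
  have hfun : (fun x =>
        (deriv (fun τ => Q τ x) 0 - ∑ k ∈ range ((ℓ + 1) / 2), b k * ι x ^ (ℓ - 2 * k)) ^ 2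
        + deriv (fun y => Q 0 y - ∑ k ∈ range (ℓ / 2 + 1), a k * ι y ^ (ℓ - 2 * k)) x ^ 2
        + V x * (Q 0 x - ∑ k ∈ range (ℓ / 2 + 1), a k * ι x ^ (ℓ - 2 * k)) ^ 2)
      = fun z =>
        ((∑ k ∈ range (ℓ / 2 + 1), a k / (∏ i ∈ range ℓ, (((2 * k : ℕ) : ℝ) - 2 * i - 1))
              * ((2 * k : ℕ) : ℝ) * E (2 * k - 1) z
          + ∑ k ∈ range ((ℓ + 1) / 2), b k / (((2 * k + 1 : ℕ) : ℝ)
              * ∏ i ∈ range ℓ, (((2 * k : ℕ) : ℝ) - 2 * i - 1)) * (((2 * k + 1 : ℕ) : ℝ) * E (2 * k) z))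
          - ∑ k ∈ range ((ℓ + 1) / 2), b k * ι z ^ (ℓ - 2 * k)) ^ 2
        + deriv (fun y =>
          (∑ k ∈ range (ℓ / 2 + 1), a k / (∏ i ∈ range ℓ, (((2 * k : ℕ) : ℝ) - 2 * i - 1)) * E (2 * k) y
          + ∑ k ∈ range ((ℓ + 1) / 2), b k / (((2 * k + 1 : ℕ) : ℝ)
              * ∏ i ∈ range ℓ, (((2 * k : ℕ) : ℝ) - 2 * i - 1)) * E (2 * k + 1) y)
          - ∑ k ∈ range (ℓ / 2 + 1), a k * ι y ^ (ℓ - 2 * k)) z ^ 2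
        + V z * ((∑ k ∈ range (ℓ / 2 + 1), a k / (∏ i ∈ range ℓ, (((2 * k : ℕ) : ℝ) - 2 * i - 1)) * E (2 * k) z
          + ∑ k ∈ range ((ℓ + 1) / 2), b k / (((2 * k + 1 : ℕ) : ℝ)
              * ∏ i ∈ range ℓ, (((2 * k : ℕ) : ℝ) - 2 * i - 1)) * E (2 * k + 1) z)
          - ∑ k ∈ range (ℓ / 2 + 1), a k * ι z ^ (ℓ - 2 * k)) ^ 2 := by
    have hpos : (fun y => Q 0 y - ∑ k ∈ range (ℓ / 2 + 1), a k * ι y ^ (ℓ - 2 * k))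
        = fun y => (∑ k ∈ range (ℓ / 2 + 1),
            a k / (∏ i ∈ range ℓ, (((2 * k : ℕ) : ℝ) - 2 * i - 1)) * E (2 * k) y
          + ∑ k ∈ range ((ℓ + 1) / 2), b k / (((2 * k + 1 : ℕ) : ℝ)
              * ∏ i ∈ range ℓ, (((2 * k : ℕ) : ℝ) - 2 * i - 1)) * E (2 * k + 1) y)
          - ∑ k ∈ range (ℓ / 2 + 1), a k * ι y ^ (ℓ - 2 * k) := funext fun y => by rw [hQ0]
    funext x
    rw [hQ1 x, hpos, hQ0 x]
  rw [hfun]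
  refine ⟨hKi, hKle.trans ?_⟩
  -- the frame bounds
  have hι1 : ∀ x, ρ ≤ x → ι x = x⁻¹ := fun x hx => hιeq x (by linarith)
  have hmono : ∀ (k : ℕ) (x : ℝ), ρ ≤ x → 2 * k ≤ ℓ →
      ι x ^ (ℓ - 2 * k) = x ^ ((((2 * k : ℕ)) : ℝ) - ℓ) := by
    intro k x hx hk
    have hx0 : 0 < x := by linarith
    rw [hι1 x hx, inv_pow, ← Real.rpow_natCast x (ℓ - 2 * k), ← Real.rpow_neg hx0.le]
    congr 1
    rw [Nat.cast_sub hk]; push_cast; ring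
  -- velocity part: `Σ b_k² ρ^{4k−2ℓ+1} ≤ σ₁⁻¹ ∫ kvel²`
  set μ : ℕ → ℝ := fun j => if Even j then b (j / 2) else 0 with hμ
  have hvel_sum : σ₁ * ∑ k ∈ range ((ℓ + 1) / 2), b k ^ 2 * ρ ^ (4 * (k : ℝ) - 2 * ℓ + 1)
      = σ₁ * ∑ j ∈ range ℓ, μ j ^ 2 * ρ ^ (2 * ((j : ℝ) - ℓ) + 1) := by
    congr 1
    symm
    calc ∑ j ∈ range ℓ, μ j ^ 2 * ρ ^ (2 * ((j : ℝ) - ℓ) + 1)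
        = ∑ j ∈ range ℓ, (if Even j then b (j / 2) ^ 2 * ρ ^ (2 * ((j : ℝ) - ℓ) + 1) else 0) :=
          Finset.sum_congr rfl fun j _ => by simp only [hμ]; split_ifs <;> simp
      _ = ∑ k ∈ range ((ℓ + 1) / 2), b (2 * k / 2) ^ 2 * ρ ^ (2 * (((2 * k : ℕ) : ℝ) - ℓ) + 1) :=
          sum_range_ite_even (fun j => b (j / 2) ^ 2 * ρ ^ (2 * ((j : ℝ) - ℓ) + 1))
            (fun k => by omega)
      _ = _ := Finset.sum_congr rfl fun k _ => by
          rw [Nat.mul_div_cancel_left k two_pos]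
          congr 2; push_cast; ring
  have hvel_fun : ∀ x ∈ Ioi ρ, (∑ j ∈ range ℓ, μ j * x ^ ((j : ℝ) - ℓ)) ^ 2
      = (∑ k ∈ range ((ℓ + 1) / 2), b k * ι x ^ (ℓ - 2 * k)) ^ 2 := by
    intro x hx
    congr 1
    calc ∑ j ∈ range ℓ, μ j * x ^ ((j : ℝ) - ℓ)
        = ∑ j ∈ range ℓ, (if Even j then b (j / 2) * x ^ ((j : ℝ) - ℓ) else 0) :=
          Finset.sum_congr rfl fun j _ => by simp only [hμ]; split_ifs <;> simp
      _ = ∑ k ∈ range ((ℓ + 1) / 2), b (2 * k / 2) * x ^ ((((2 * k : ℕ)) : ℝ) - ℓ) :=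
          sum_range_ite_even (fun j => b (j / 2) * x ^ ((j : ℝ) - ℓ)) (fun k => by omega)
      _ = _ := Finset.sum_congr rfl fun k hk => by
          rw [Nat.mul_div_cancel_left k two_pos,
            hmono k x (le_of_lt hx) (by have := Finset.mem_range.1 hk; omega)]
  have hvel : ∑ k ∈ range ((ℓ + 1) / 2), b k ^ 2 * ρ ^ (4 * (k : ℝ) - 2 * ℓ + 1)
      ≤ σ₁⁻¹ * ∫ x in Ioi ρ, ((∑ k ∈ range ((ℓ + 1) / 2), b k * ι x ^ (ℓ - 2 * k)) ^ 2
        + deriv (fun y => ∑ k ∈ range (ℓ / 2 + 1), a k * ι y ^ (ℓ - 2 * k)) x ^ 2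
        + ℓ * (ℓ + 1) * ι x ^ 2 * (∑ k ∈ range (ℓ / 2 + 1), a k * ι x ^ (ℓ - 2 * k)) ^ 2) := by
    have h1 := hF₁ μ ρ hρ1
    rw [← hvel_sum, setIntegral_congr_fun measurableSet_Ioi hvel_fun] at h1
    have h2 : ∫ x in Ioi ρ, (∑ k ∈ range ((ℓ + 1) / 2), b k * ι x ^ (ℓ - 2 * k)) ^ 2
        ≤ ∫ x in Ioi ρ, ((∑ k ∈ range ((ℓ + 1) / 2), b k * ι x ^ (ℓ - 2 * k)) ^ 2
          + deriv (fun y => ∑ k ∈ range (ℓ / 2 + 1), a k * ι y ^ (ℓ - 2 * k)) x ^ 2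
          + ℓ * (ℓ + 1) * ι x ^ 2 * (∑ k ∈ range (ℓ / 2 + 1), a k * ι x ^ (ℓ - 2 * k)) ^ 2) :=
      integral_mono_of_nonneg (ae_of_all _ fun x => sq_nonneg _) hkex (ae_of_all _ fun x => by
        have : 0 ≤ ι x ^ 2 * (∑ k ∈ range (ℓ / 2 + 1), a k * ι x ^ (ℓ - 2 * k)) ^ 2 := by
          positivity
        nlinarith [sq_nonneg (deriv (fun y => ∑ k ∈ range (ℓ / 2 + 1), a k * ι y ^ (ℓ - 2 * k)) x)])
    rw [le_inv_mul_iff₀ hσ₁]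
    exact h1.trans h2
  -- position part: `Σ a_k² ρ^{4k−2ℓ−1} ≤ (2σ₂)⁻¹ ∫ ℓ(ℓ+1)ι² kpos²`
  set μ' : ℕ → ℝ := fun j => if Even j then a (j / 2) else 0 with hμ'
  have hpos_sum : σ₂ * ∑ k ∈ range (ℓ / 2 + 1), a k ^ 2 * ρ ^ (4 * (k : ℝ) - 2 * ℓ - 1)
      = σ₂ * ∑ j ∈ range (ℓ + 1), μ' j ^ 2 * ρ ^ (2 * ((j : ℝ) - ℓ) - 1) := by
    congr 1
    symm
    calc ∑ j ∈ range (ℓ + 1), μ' j ^ 2 * ρ ^ (2 * ((j : ℝ) - ℓ) - 1)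
        = ∑ j ∈ range (ℓ + 1), (if Even j then a (j / 2) ^ 2 * ρ ^ (2 * ((j : ℝ) - ℓ) - 1) else 0) :=
          Finset.sum_congr rfl fun j _ => by simp only [hμ']; split_ifs <;> simp
      _ = ∑ k ∈ range (ℓ / 2 + 1), a (2 * k / 2) ^ 2 * ρ ^ (2 * (((2 * k : ℕ) : ℝ) - ℓ) - 1) :=
          sum_range_ite_even (fun j => a (j / 2) ^ 2 * ρ ^ (2 * ((j : ℝ) - ℓ) - 1))
            (fun k => by omega)
      _ = _ := Finset.sum_congr rfl fun k _ => by
          rw [Nat.mul_div_cancel_left k two_pos]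
          congr 2; push_cast; ring
  have hpos_fun : ∀ x ∈ Ioi ρ, x ^ (-(2 : ℝ)) * (∑ j ∈ range (ℓ + 1), μ' j * x ^ ((j : ℝ) - ℓ)) ^ 2
      = ι x ^ 2 * (∑ k ∈ range (ℓ / 2 + 1), a k * ι x ^ (ℓ - 2 * k)) ^ 2 := by
    intro x hx
    have hx0 : 0 < x := hρ0.trans hx
    have e1 : x ^ (-(2 : ℝ)) = ι x ^ 2 := by
      rw [hι1 x (le_of_lt hx), Real.rpow_neg hx0.le, Real.rpow_two, inv_pow]
    rw [e1]
    congr 2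
    calc ∑ j ∈ range (ℓ + 1), μ' j * x ^ ((j : ℝ) - ℓ)
        = ∑ j ∈ range (ℓ + 1), (if Even j then a (j / 2) * x ^ ((j : ℝ) - ℓ) else 0) :=
          Finset.sum_congr rfl fun j _ => by simp only [hμ']; split_ifs <;> simp
      _ = ∑ k ∈ range (ℓ / 2 + 1), a (2 * k / 2) * x ^ ((((2 * k : ℕ)) : ℝ) - ℓ) :=
          sum_range_ite_even (fun j => a (j / 2) * x ^ ((j : ℝ) - ℓ)) (fun k => by omega)
      _ = _ := Finset.sum_congr rfl fun k hk => by
          rw [Nat.mul_div_cancel_left k two_pos,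
            hmono k x (le_of_lt hx) (by have := Finset.mem_range.1 hk; omega)]
  have hposb : ∑ k ∈ range (ℓ / 2 + 1), a k ^ 2 * ρ ^ (4 * (k : ℝ) - 2 * ℓ - 1)
      ≤ (2 * σ₂)⁻¹ * ∫ x in Ioi ρ, ((∑ k ∈ range ((ℓ + 1) / 2), b k * ι x ^ (ℓ - 2 * k)) ^ 2
        + deriv (fun y => ∑ k ∈ range (ℓ / 2 + 1), a k * ι y ^ (ℓ - 2 * k)) x ^ 2
        + ℓ * (ℓ + 1) * ι x ^ 2 * (∑ k ∈ range (ℓ / 2 + 1), a k * ι x ^ (ℓ - 2 * k)) ^ 2) := by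
    have h1 := hF₂ μ' ρ hρ1
    rw [← hpos_sum, setIntegral_congr_fun measurableSet_Ioi hpos_fun] at h1
    have h2 : ∫ x in Ioi ρ, ι x ^ 2 * (∑ k ∈ range (ℓ / 2 + 1), a k * ι x ^ (ℓ - 2 * k)) ^ 2
        ≤ ∫ x in Ioi ρ, (1 / 2) * ((∑ k ∈ range ((ℓ + 1) / 2), b k * ι x ^ (ℓ - 2 * k)) ^ 2
          + deriv (fun y => ∑ k ∈ range (ℓ / 2 + 1), a k * ι y ^ (ℓ - 2 * k)) x ^ 2
          + ℓ * (ℓ + 1) * ι x ^ 2 * (∑ k ∈ range (ℓ / 2 + 1), a k * ι x ^ (ℓ - 2 * k)) ^ 2) :=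
      integral_mono_of_nonneg (ae_of_all _ fun x => by positivity) (hkex.const_mul _)
        (ae_of_all _ fun x => by
          have h0 : 0 ≤ ι x ^ 2 * (∑ k ∈ range (ℓ / 2 + 1), a k * ι x ^ (ℓ - 2 * k)) ^ 2 := by
            positivity
          nlinarith [sq_nonneg (deriv (fun y => ∑ k ∈ range (ℓ / 2 + 1), a k * ι y ^ (ℓ - 2 * k)) x),
            sq_nonneg (∑ k ∈ range ((ℓ + 1) / 2), b k * ι x ^ (ℓ - 2 * k))])
    rw [integral_const_mul] at h2
    rw [le_inv_mul_iff₀ (by positivity)]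
    calc 2 * σ₂ * ∑ k ∈ range (ℓ / 2 + 1), a k ^ 2 * ρ ^ (4 * (k : ℝ) - 2 * ℓ - 1)
        = 2 * (σ₂ * ∑ k ∈ range (ℓ / 2 + 1), a k ^ 2 * ρ ^ (4 * (k : ℝ) - 2 * ℓ - 1)) := by ring
      _ ≤ 2 * ((1 / 2) * ∫ x in Ioi ρ, ((∑ k ∈ range ((ℓ + 1) / 2), b k * ι x ^ (ℓ - 2 * k)) ^ 2
          + deriv (fun y => ∑ k ∈ range (ℓ / 2 + 1), a k * ι y ^ (ℓ - 2 * k)) x ^ 2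
          + ℓ * (ℓ + 1) * ι x ^ 2 * (∑ k ∈ range (ℓ / 2 + 1), a k * ι x ^ (ℓ - 2 * k)) ^ 2)) :=
          mul_le_mul_of_nonneg_left (h1.trans h2) (by norm_num)
      _ = _ := by ring
  -- conclusion
  have hI0 : 0 ≤ ∫ x in Ioi ρ, ((∑ k ∈ range ((ℓ + 1) / 2), b k * ι x ^ (ℓ - 2 * k)) ^ 2
        + deriv (fun y => ∑ k ∈ range (ℓ / 2 + 1), a k * ι y ^ (ℓ - 2 * k)) x ^ 2
        + ℓ * (ℓ + 1) * ι x ^ 2 * (∑ k ∈ range (ℓ / 2 + 1), a k * ι x ^ (ℓ - 2 * k)) ^ 2) :=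
    setIntegral_nonneg measurableSet_Ioi fun x _ => by positivity
  calc Kt / ρ * (∑ k ∈ range (ℓ / 2 + 1), a k ^ 2 * ρ ^ (4 * (k : ℝ) - 2 * ℓ - 1)
          + ∑ k ∈ range ((ℓ + 1) / 2), b k ^ 2 * ρ ^ (4 * (k : ℝ) - 2 * ℓ + 1))
      ≤ Kt / ρ * ((2 * σ₂)⁻¹ * (∫ x in Ioi ρ, ((∑ k ∈ range ((ℓ + 1) / 2), b k * ι x ^ (ℓ - 2 * k)) ^ 2
        + deriv (fun y => ∑ k ∈ range (ℓ / 2 + 1), a k * ι y ^ (ℓ - 2 * k)) x ^ 2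
        + ℓ * (ℓ + 1) * ι x ^ 2 * (∑ k ∈ range (ℓ / 2 + 1), a k * ι x ^ (ℓ - 2 * k)) ^ 2))
        + σ₁⁻¹ * ∫ x in Ioi ρ, ((∑ k ∈ range ((ℓ + 1) / 2), b k * ι x ^ (ℓ - 2 * k)) ^ 2
        + deriv (fun y => ∑ k ∈ range (ℓ / 2 + 1), a k * ι y ^ (ℓ - 2 * k)) x ^ 2
        + ℓ * (ℓ + 1) * ι x ^ 2 * (∑ k ∈ range (ℓ / 2 + 1), a k * ι x ^ (ℓ - 2 * k)) ^ 2)) :=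
        mul_le_mul_of_nonneg_left (add_le_add hposb hvel) (by positivity)
    _ = _ := by ring

end Literature.Analysis.PDE
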